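import Literature.Barriers.RiemannHypothesis.PseudoLaplacianSpacing
import Literature.NumberTheory.LFunctions.PairCorrelationSmallGaps
import HarnessLib

/-!
# `SmallGapsBelowHalfSpacing` from pair correlation, and Bombieri–Garrett's Corollary 69 on pair correlation alone — proved

Barrier catalogue `Literature/Barriers/RiemannHypothesis/` (D-0021), companion of
`PseudoLaplacianSpacing.lean` (Bombieri–Garrett 2020, Thm. 67, Cor. 68–69, Remark 70). Proofs
only (no definitions, no named facts).

`PseudoLaplacianSpacing.lean` records Bombieri–Garrett's small-gap input as the bare hypothesis
`SmallGapsBelowHalfSpacing` (a positive proportion of consecutive distinct ordinates of zeros of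
`ζ` are at most `μ < 1/2` mean spacings apart) and proves the barrier `PseudoLaplacianSpacing`
from it. As an assertion about the zeros, `SmallGapsBelowHalfSpacing` is an OPEN problem (it is
not known even on the Riemann Hypothesis); what the source prints (§7.5, before Corollary 69) is
conditional: "assuming the Riemann Hypothesis and pair correlation … the asymptotic fraction of
pairs of zeros within half the average spacing `2π/log T` up to height `T` is
`∫₀^{1/2} (1 − (sin πu/πu)²) du ≈ 0.11315 > 0`. From the lower bound in the previous section,
for at least one of every such pair `(m, n)` the corresponding zero cannot appear among discrete
spectrum parameters `w` for `S̃_θ`." This file formalises that deduction: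

* `SmallGapsBelowHalfSpacing.of_pairCorrelation` — Montgomery's pair correlation conjecture
  (`Literature.NumberTheory.LFunctions.MontgomeryPairCorrelation`, Montgomery 1973, (12), the
  `N(T)`-normalised form with the `δ`-term) implies `SmallGapsBelowHalfSpacing` (with `μ = 1/4`);
  the work is `Literature.NumberTheory.LFunctions.MontgomeryPairCorrelation.smallGaps`
  (`PairCorrelationSmallGaps.lean`: every scale `μ > 0`). RH is not used: the tree's pair
  correlation conjecture is a statement about the ordinates.
* `SmallGapsBelowHalfSpacing.of_riemannHypothesis_of_pairCorrelation` — the printed hypotheses.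
* `pseudoLaplacianSpacing_of_pairCorrelation` — Corollary 69 in logical form on pair correlation
  alone: every `BGSpacing` set misses one of `γ_n, γ_{n+1}` for a positive proportion of
  `n < N(T)` (the barrier with its three hypotheses discharged: `mem_zeroIndexSet_iff_holds`,
  `tendsto_zetaZeroCount_atTop_holds`, and the previous item).
* `BGSpacing.exists_not_mem_of_pairCorrelation` — Remark 70 on pair correlation alone.

Not formalised: the figure "94%" (`1 − 0.113/2`), and Corollary 68 itself (that the spectral
parameters of `S̃_θ` form a `BGSpacing` set), which stays in prose as in the main file.

## References

* E. Bombieri, P. Garrett, *Designed pseudo-Laplacians*, arXiv:2002.07929 (2020), §7.5: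
  Corollary 69, Remarks 70–71 and the pair-correlation paragraph following them (read).
  [key `BombieriGarrett2020`]
* H. L. Montgomery, *The pair correlation of zeros of the zeta function*, Proc. Sympos. Pure
  Math. 24 (1973), 181–193, (12). [key `Montgomery1973`]
-/

noncomputable section

open Literature.NumberTheory.LFunctions

namespace Literature.Barriers.RiemannHypothesis

/-- **`SmallGapsBelowHalfSpacing` follows from Montgomery's pair correlation conjecture** — the
conditional form, as printed, of the hypothesis `SmallGapsBelowHalfSpacing` of
`PseudoLaplacianSpacing.lean`: Bombieri–Garrett, §7.5, take their small-gap input "assuming the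
Riemann Hypothesis and pair correlation" ("the asymptotic fraction of pairs of zeros within half
the average spacing `2π/log T` up to height `T` is `∫₀^{1/2}(1 − (sin πu/πu)²) du ≈ 0.11315 > 0`").
Here the tree's `MontgomeryPairCorrelation` (Montgomery 1973, (12), `N(T)`-normalised with the
`δ`-term — a statement about the ordinates, so RH plays no role in the deduction) gives a positive
proportion of consecutive distinct ordinates within `μ = 1/4 < 1/2` mean spacings
(`MontgomeryPairCorrelation.smallGaps`, any `μ > 0`). [cite: BombieriGarrett2020, §7.5] -/
theorem SmallGapsBelowHalfSpacing.of_pairCorrelation (hpc : MontgomeryPairCorrelation) :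
    SmallGapsBelowHalfSpacing := by
  obtain ⟨A, hA, T₀, h⟩ := hpc.smallGaps (show (0 : ℝ) < 1 / 4 by norm_num)
  exact ⟨1 / 4, by norm_num, A, hA, T₀, h⟩

/-- The printed hypotheses of Bombieri–Garrett §7.5, "assuming the Riemann Hypothesis and pair
correlation", imply the small-gap input (RH is not used). [cite: BombieriGarrett2020, §7.5] -/
theorem SmallGapsBelowHalfSpacing.of_riemannHypothesis_of_pairCorrelation
    (_hRH : RiemannHypothesis) (hpc : MontgomeryPairCorrelation) : SmallGapsBelowHalfSpacing :=
  SmallGapsBelowHalfSpacing.of_pairCorrelation hpc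

open scoped Classical in
/-- **Corollary 69 on pair correlation alone (logical form).** Assuming Montgomery's pair
correlation conjecture, no `BGSpacing` set `S` — in particular (Corollary 68) the set of spectral
parameters `τ` of the eigenvalues `λ_{1/2+iτ} > 1/4` of a Bombieri–Garrett pseudo-Laplacian
`S̃_θ` — contains both `γ_n` and `γ_{n+1}` for more than a proportion `1 − A` of the indices
`n < N(T)`, `T ≥ T₀`: "At most 94% of the zeros of `ζ(s)` give eigenvalues `λ_s = s(1−s)` for
`S̃_θ`" (the figure is not formalised). This is `PseudoLaplacianSpacing_holds` with its three
hypotheses discharged (`mem_zeroIndexSet_iff_holds`, `tendsto_zetaZeroCount_atTop_holds`,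
`SmallGapsBelowHalfSpacing.of_pairCorrelation`). [cite: BombieriGarrett2020, Corollary 69] -/
theorem pseudoLaplacianSpacing_of_pairCorrelation (hpc : MontgomeryPairCorrelation) (S : Set ℝ)
    (hS : BGSpacing S) :
    ∃ A : ℝ, 0 < A ∧ ∃ T₀ : ℝ, ∀ T : ℝ, T₀ ≤ T →
      A * (zetaZeroCount T : ℝ) ≤
        (((zeroIndexSet T).filter fun n ↦
          zetaOrdinate n ∉ S ∨ zetaOrdinate (n + 1) ∉ S).card : ℝ) :=
  PseudoLaplacianSpacing_holds mem_zeroIndexSet_iff_holds tendsto_zetaZeroCount_atTop_holds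
    (SmallGapsBelowHalfSpacing.of_pairCorrelation hpc) S hS

/-- **Remark 70 on pair correlation alone**: assuming Montgomery's pair correlation conjecture,
no `BGSpacing` set contains all ordinates of zeros of `ζ` beyond any height `T` — "it cannot be
the case that all zeros `ρ_j` of `ζ(s)` give eigenvalues for `S̃_θ`".
[cite: BombieriGarrett2020, Remark 70] -/
theorem BGSpacing.exists_not_mem_of_pairCorrelation (hpc : MontgomeryPairCorrelation)
    {S : Set ℝ} (hS : BGSpacing S) (T : ℝ) :
    ∃ n : ℕ, T < zetaOrdinate n ∧ zetaOrdinate n ∉ S :=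
  hS.exists_not_mem mem_zeroIndexSet_iff_holds tendsto_zetaZeroCount_atTop_holds
    (SmallGapsBelowHalfSpacing.of_pairCorrelation hpc) T

end Literature.Barriers.RiemannHypothesis

end
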